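import Summits.Ventures.PercRepro.ProfilePointedCircuitClassesStarSharpD0O

/-!
# PercRepro — CASE D0 OF `StarNineSharp`, PART P: THE «NO ON LINE THROUGH `e`, NO ON PLANE THROUGH `e, f`»
REGIME IS PROVED (p5, gen 54; `proofs/P5-GM1.md` §81 ADD 1)

The ON demands split by R0 (the swap is an ON bi-independent set), then by the OFF / ON status of `X ∖ π`; the
three injections `d0_injR0` (into the ON targets avoiding `e`), `d0_injR2'` (into the bi-bases containing `e, f`)
and `d0_injR3'` (into the sets `{e, f, z} + b`) together with D0A's OFF map give
**`inCount_thru_le_of_no_on_line_e_no_ef`**: with ON lines allowed away from `e` (no ON line through `e`) and no ON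
plane through `e, f`, the `b′`-avoiding two-point inequality holds (9,227 + 11,013 further D0 configurations).
-/

open scoped Matroid

namespace PercRepro.Cogirth

open Finset ThmH Skew Shadow Profile

open Classical

variable {α : Type} [DecidableEq α] {N : Matroid α} [N.Finite]

section StarSharpD0P

variable {b b' : α}

/-- **RULE R2** in this regime: the demands with `¬ R0` and OFF complement go to the bi-basis `π + e + f`. -/
theorem d0_injR2' (hn : (gr N).card = 9) (hR : rk N (gr N) = 5)
    (hcf : ∀ x ∈ gr N, rk N ((gr N).erase x) = 5) (h : SeriesPair N b b')
    {e f : α} (he : e ∈ gr N) (hf : f ∈ gr N) (hef : e ≠ f) (heb : e ≠ b) (heb' : e ≠ b') (hfb : f ≠ b) (hfb' : f ≠ b')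
    (hE7 : rk N (((gr N).erase b).erase b') = 4)
    (hnle : ∀ S : Finset α, S ⊆ ((gr N).erase b).erase b' → e ∈ S → rk N (insert b (insert b' S)) ≤ 3 → rk N S ≤ 1)
    (he1 : ∀ y ∈ ((((gr N).erase b).erase b').erase f).erase e, rk N {e, y} = 2)
    (hfc : ∀ y ∈ ((((gr N).erase b).erase b').erase f).erase e, rk N (((((gr N).erase b).erase b').erase f).erase y) = 4)
    (hX : rk N (((((gr N).erase b).erase b').erase f).erase e) = 4) :
    ((d0DON N b' e f).filter (fun W => (¬ d0c0 N b b' e f W ∧ d0c1 N b e f W) ∧ d0c2 N b b' e f W)).card ≤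
      ((biIndepSets N 4).filter (fun W => (f ∈ W ∧ b' ∉ W) ∧ (e ∈ W ∧ b ∉ W))).card := by
  have _ := hR; have _ := hcf; have _ := hE7; have _ := hnle; have _ := he1; have _ := hfc; have _ := hX
  have hXE : ((((gr N).erase b).erase b').erase f).erase e ⊆ ((gr N).erase b).erase b' := (erase_subset _ _).trans (erase_subset _ _)
  have heE : e ∈ ((gr N).erase b).erase b' := mem_erase.2 ⟨heb', mem_erase.2 ⟨heb, he⟩⟩
  have hfE : f ∈ ((gr N).erase b).erase b' := mem_erase.2 ⟨hfb', mem_erase.2 ⟨hfb, hf⟩⟩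
  have heX : e ∉ ((((gr N).erase b).erase b').erase f).erase e := fun h' => (mem_erase.1 h').1 rfl
  have hfX : f ∉ ((((gr N).erase b).erase b').erase f).erase e := fun h' => (mem_erase.1 (mem_erase.1 h').2).1 rfl
  have hdata := d0_demand_data h hn hf hef heb hfb hfb' (e := e)
  apply card_le_card_of_injOn (fun W => insert f (W.erase b))
  · intro W hW
    simp only [d0DON, mem_coe, mem_filter] at hW
    obtain ⟨⟨hWs, hPD, hcW⟩, ⟨-, hc1⟩, hc₂⟩ := hW
    obtain ⟨hbW, hπX, hπ2, hYeq, hWeq, hYr, hYc, hYon⟩ := hdata W hWs hPD hcW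
    have hYE : insert e ((W.erase b).erase e) ⊆ ((gr N).erase b).erase b' := insert_subset heE (hπX.trans hXE)
    have hf4 : rk N (insert f (insert e ((W.erase b).erase e))) = 4 := hc1
    have hfπ : f ∉ (W.erase b).erase e := fun h' => hfX (hπX h')
    have heπ : e ∉ (W.erase b).erase e := fun h' => heX (hπX h')
    have hWE : insert f (W.erase b) ⊆ ((gr N).erase b).erase b' := by
      rw [← hYeq]; exact insert_subset hfE hYE
    have hW4 : (insert f (W.erase b)).card = 4 := by
      rw [← hYeq, card_insert_of_notMem, card_insert_of_notMem heπ, hπ2]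
      simp only [mem_insert, not_or]; exact ⟨hef.symm, hfπ⟩
    simp only [mem_coe, mem_filter]
    refine ⟨?_, ⟨mem_insert_self _ _, ?_⟩, mem_insert_of_mem (mem_erase.2 ⟨heb, hPD.1.1⟩), ?_⟩
    · rw [mem_biIndepSets_iff_of_subset_E7 h hn hWE hW4, ← hYeq, E7_sdiff_insert_ef_eq]
      exact ⟨hf4, hc₂⟩
    · intro h'
      rcases mem_insert.1 h' with h2 | h2
      · exact hfb' h2.symm
      · exact hPD.2 (mem_of_mem_erase h2)
    · intro h'
      rcases mem_insert.1 h' with h2 | h2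
      · exact hfb h2.symm
      · exact (mem_erase.1 h2).1 rfl
  · intro W₁ hW₁ W₂ hW₂ heq
    simp only [d0DON, mem_coe, mem_filter] at hW₁ hW₂
    obtain ⟨hb₁, -, -, -, -, -, -, -⟩ := hdata W₁ hW₁.1.1 hW₁.1.2.1 hW₁.1.2.2
    obtain ⟨hb₂, -, -, -, -, -, -, -⟩ := hdata W₂ hW₂.1.1 hW₂.1.2.1 hW₂.1.2.2
    have hf₁ : f ∉ W₁.erase b := fun h' => hW₁.1.2.1.1.2 (mem_of_mem_erase h')
    have hf₂ : f ∉ W₂.erase b := fun h' => hW₂.1.2.1.1.2 (mem_of_mem_erase h')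
    have e2 : W₁.erase b = W₂.erase b := by
      rw [← erase_insert hf₁, ← erase_insert hf₂]
      simp only at heq
      rw [heq]
    rw [← insert_erase hb₁, ← insert_erase hb₂, e2]

/-- **THE «NO ON LINE THROUGH `e`, NO ON PLANE THROUGH `e, f`» REGIME OF CASE D0.** -/
theorem inCount_thru_le_of_no_on_line_e_no_ef (hn : (gr N).card = 9) (hR : rk N (gr N) = 5)
    (hcf : ∀ x ∈ gr N, rk N ((gr N).erase x) = 5) (h : SeriesPair N b b')
    {e f : α} (he : e ∈ gr N) (hf : f ∈ gr N) (hef : e ≠ f) (heb : e ≠ b) (heb' : e ≠ b') (hfb : f ≠ b) (hfb' : f ≠ b')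
    (hE7 : rk N (((gr N).erase b).erase b') = 4)
    (hnle : ∀ S : Finset α, S ⊆ ((gr N).erase b).erase b' → e ∈ S → rk N (insert b (insert b' S)) ≤ 3 → rk N S ≤ 1)
    (he1 : ∀ y ∈ ((((gr N).erase b).erase b').erase f).erase e, rk N {e, y} = 2)
    (hfc : ∀ y ∈ ((((gr N).erase b).erase b').erase f).erase e, rk N (((((gr N).erase b).erase b').erase f).erase y) = 4)
    (hX : rk N (((((gr N).erase b).erase b').erase f).erase e) = 4)
    (hefp : ∀ Y : Finset α, Y ⊆ ((gr N).erase b).erase b' → e ∈ Y → f ∈ Y → rk N Y = 3 →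
      rk N (insert b (insert b' Y)) = 5) :
    inCount N 4 e + thruCount N 4 {b', f} + thruCount N 4 {b', e, f} ≤
      inCount N 4 f + thruCount N 4 {e, f} + thruCount N 4 {b', e} := by
  rw [inCount_thru_split']
  have hsplit := card_filter_add_card_filter_not (s := (biIndepSets N 4).filter (fun W => (e ∈ W ∧ f ∉ W) ∧ b' ∉ W))
    (fun W => (gr N \ W).erase b' ∈ biIndepSets N 4)
  simp only [filter_filter] at hsplit
  have htar : ((biIndepSets N 4).filter (fun W => (f ∈ W ∧ b' ∉ W) ∧ (e ∉ W ∧ (gr N \ W).erase b' ∈ biIndepSets N 4))).card +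
      ((biIndepSets N 4).filter (fun W => (f ∈ W ∧ b' ∉ W) ∧ (e ∉ W ∧ b ∈ W ∧ ¬ (gr N \ W).erase b' ∈ biIndepSets N 4))).card +
      ((biIndepSets N 4).filter (fun W => (f ∈ W ∧ b' ∉ W) ∧ (e ∈ W ∧ b ∉ W))).card +
      ((biIndepSets N 4).filter (fun W => (f ∈ W ∧ b' ∉ W) ∧ (e ∈ W ∧ b ∈ W ∧ (gr N \ W).erase b' ∈ biIndepSets N 4))).card +
      ((biIndepSets N 4).filter (fun W => (f ∈ W ∧ b' ∉ W) ∧ (e ∈ W ∧ b ∈ W ∧ ¬ (gr N \ W).erase b' ∈ biIndepSets N 4))).card ≤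
      ((biIndepSets N 4).filter (fun W => f ∈ W ∧ b' ∉ W)).card := by
    rw [← card_union_of_disjoint, ← card_union_of_disjoint, ← card_union_of_disjoint, ← card_union_of_disjoint]
    · apply card_le_card
      intro W hW
      simp only [mem_union, mem_filter] at hW ⊢
      rcases hW with (((hW | hW) | hW) | hW) | hW <;> exact ⟨hW.1, hW.2.1⟩
    · rw [disjoint_union_left, disjoint_union_left, disjoint_union_left]
      refine ⟨⟨⟨?_, ?_⟩, ?_⟩, ?_⟩ <;> rw [disjoint_filter]
      · rintro W _ ⟨-, heW, -⟩ ⟨-, heW', -, -⟩; exact heW heW'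
      · rintro W _ ⟨-, heW, -, -⟩ ⟨-, heW', -, -⟩; exact heW heW'
      · rintro W _ ⟨-, -, hbW⟩ ⟨-, -, hbW', -⟩; exact hbW hbW'
      · rintro W _ ⟨-, -, -, hc⟩ ⟨-, -, -, hc'⟩; exact hc' hc
    · rw [disjoint_union_left, disjoint_union_left]
      refine ⟨⟨?_, ?_⟩, ?_⟩ <;> rw [disjoint_filter]
      · rintro W _ ⟨-, heW, -⟩ ⟨-, heW', -, -⟩; exact heW heW'
      · rintro W _ ⟨-, heW, -, -⟩ ⟨-, heW', -, -⟩; exact heW heW'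
      · rintro W _ ⟨-, -, hbW⟩ ⟨-, -, hbW', -⟩; exact hbW hbW'
    · rw [disjoint_union_left]
      refine ⟨?_, ?_⟩ <;> rw [disjoint_filter]
      · rintro W _ ⟨-, heW, -⟩ ⟨-, heW', -⟩; exact heW heW'
      · rintro W _ ⟨-, heW, -, -⟩ ⟨-, heW', -⟩; exact heW heW'
    · rw [disjoint_filter]
      rintro W _ ⟨-, -, hc⟩ ⟨-, -, -, hc'⟩; exact hc' hc
  have hinj1 := card_off_demands_le (N := N) (b' := b') (e := e) hf hfb'
  have hs1 := card_filter_add_card_filter_not (s := d0DON N b' e f) (fun W => d0c0 N b b' e f W)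
  have hs1' := card_filter_add_card_filter_not (s := (d0DON N b' e f).filter (fun W => ¬ d0c0 N b b' e f W))
    (fun W => d0c1 N b e f W)
  have hs2 := card_filter_add_card_filter_not
    (s := ((d0DON N b' e f).filter (fun W => ¬ d0c0 N b b' e f W)).filter (fun W => d0c1 N b e f W))
    (fun W => d0c2 N b b' e f W)
  simp only [filter_filter] at hs1' hs2
  -- no demand lies on an `ef`-plane
  have hempty : ((d0DON N b' e f).filter (fun W => ¬ d0c0 N b b' e f W ∧ ¬ d0c1 N b e f W)).card = 0 := by
    rw [card_eq_zero, filter_eq_empty_iff]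
    intro W hW hc
    obtain ⟨-, hnc1⟩ := hc
    simp only [d0DON, mem_filter] at hW
    obtain ⟨hWs, hPD, hcW⟩ := hW
    obtain ⟨-, hπX, hπ2, -, -, hYr, -, hYon⟩ := d0_demand_data h hn hf hef heb hfb hfb' W hWs hPD hcW
    have hXE : ((((gr N).erase b).erase b').erase f).erase e ⊆ ((gr N).erase b).erase b' :=
      (erase_subset _ _).trans (erase_subset _ _)
    have hYE : insert e ((W.erase b).erase e) ⊆ ((gr N).erase b).erase b' :=
      insert_subset (mem_erase.2 ⟨heb', mem_erase.2 ⟨heb, he⟩⟩) (hπX.trans hXE)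
    have hY3 : (insert e ((W.erase b).erase e)).card = 3 := by
      rw [card_insert_of_notMem (fun h' => (mem_erase.1 (hπX h')).1 rfl), hπ2]
    exact hnc1 (rk_insert_f_eq_four_of_no_ef_plane hf hfb hfb' hefp hYE (mem_insert_self _ _) hY3 hYr hYon)
  have hinjR0 := d0_injR0 h hn he hf hef heb heb' hfb hfb'
  have hinjR2 := d0_injR2' hn hR hcf h he hf hef heb heb' hfb hfb' hE7 hnle he1 hfc hX
  have hinjR3 := d0_injR3' hn hR hcf h he hf hef heb heb' hfb hfb' hE7 hnle he1 hfc hX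
  have hDON : (d0DON N b' e f).card = ((biIndepSets N 4).filter (fun W => ((e ∈ W ∧ f ∉ W) ∧ b' ∉ W) ∧
      ¬ (gr N \ W).erase b' ∈ biIndepSets N 4)).card := rfl
  rw [← hDON] at hsplit
  omega

end StarSharpD0P

end PercRepro.Cogirth
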